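import Summits.HodgeConjecture.HodgeConjecture.Theorems.NikulinTwinTransportSquareGlueDegreeFour
import Summits.HodgeConjecture.HodgeConjecture.Theorems.NikulinTwinTransportSquareGlueDegreesTwoSix
import Summits.HodgeConjecture.HodgeConjecture.Theorems.NikulinTwinTransportRealMultiplicationFibreIntegral
import Literature.AlgebraicGeometry.HodgeTheory.HodgeFiltrationModelsReductionProofs
import Literature.AlgebraicGeometry.Surfaces.K3BettiNumbers
import Literature.AlgebraicGeometry.HodgeTheory.KunnethCrossProductsSpanProofs

/-!
# Route NikulinTwinTransport · `SquareGlue` (stmt-HodgeConjecture-13682) — the glue, modulo the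
# tree's named facts and the Künneth spanning property

The glue item `SquareGlue` of route NikulinTwinTransport is
`RealMultiplicationSqrtTwoAlgebraic → LefschetzOneOneK3 → SquareHodgeOfSqrtTwo`: on the route's sector
(projective K3 surfaces `S` with real multiplication `e` by `√2`, `End_Hdg(T) = ℚ + ℚe`) the Künneth
bookkeeping (Varesco 2023, p. 8: "proving the Hodge conjecture for `X²` is equivalent to showing that
every element of `End_Hdg(T(X))` is algebraic") turns "`e` is algebraic" and Lefschetz `(1,1)` into
`HodgeConjectureFor 4 (S ⊗ S)`.

WHAT IS PROVED: `squareHodge_cyclePart_of_facts` — the CYCLE PART of the sector (every rational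
`(p,p)`-class on `S ⊗ S` is algebraic) — and `squareGlue_of_facts` — `SquareGlue` itself, adding
`nonempty_hodgeModel` for the model conjunct only — from
* the named facts `exists_deRhamIsoFamily` (de Rham), `Huybrechts_K3_marking_exists`,
  `Huybrechts_K3_hodgeTypes_H2`, `Grothendieck1969_supportedClasses_le_hodgeConiveau`
  (+ `nonempty_hodgeModel` for the glue; `hodgePQ_independent_of_hodgeModel` is the tree's theorem
  `hodgePQ_independent_of_hodgeModel_holds` and is discharged here),
* the vanishing of the odd cohomology of a projective K3 surface (`OddBettiVanish`, inline: `H¹ = H³ = 0`;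
  Huybrechts, *Lectures on K3 Surfaces*, Ch. 1 §3.2–3.3 — the body of the named fact
  `Huybrechts_K3_oddBetti_vanish` proposed separately for `Literature/AlgebraicGeometry/Surfaces/K3BettiNumbers`),
* the spanning half of the Künneth formula for the complex points of products of smooth projective
  varieties (`hK`, the inline hypothesis shared by this route's files — Hatcher Thm. 3.15).
WHY NOT UNCONDITIONALLY: the first conjunct `Nonempty (HodgeModel 4 (S ⊗ S))` of
`HodgeConjectureFor 4 (S ⊗ S)` is the named fact `nonempty_hodgeModel` (a Hodge model needs de Rham's
theorem on a `4`-dimensional model space and the Hodge decomposition, both undischarged in the tree),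
and no hypothesis of the glue supplies a model of `S ⊗ S`.

The cycle part, degree by degree: `p = 0` (`N⁰H⁰ = H⁰`), `p = 1` and `p = 3`
(`mem_algebraicClasses_one/three_of_kunneth`), `p = 2` (`mem_algebraicClasses_two_of_sector`, the
heart), `p = 4` (top degree), `p ≥ 5` (`H = 0`). Consequence recorded for the route:
`assembly_of_facts` (the frame item 13942 modulo the facts above, through seat 3's
`assembly_of_squareGlue_of_kunneth`). A parallel closing form with a different trust base (Hodge index
and `CupPreservesHodgeType` as hypotheses, `b₁ = 0` inline) was landed by the seat of item 13680 as
`squareGlue_of_kunneth` (`…SquareHodgeOfSqrtTwoOfKunneth`); the present one avoids the Hodge index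
theorem (`ε` forces `NS ∩ NS^⊥ = 0`) and `nonempty_hodgeModel` in the cycle part.
Prover seat prover-pitem-stmt-HodgeConjecture-13682-0.
-/

noncomputable section

namespace Summit.HodgeConjecture.HodgeConjecture.Theorems.NikulinTwinTransport

open scoped Manifold
open Module CategoryTheory MonoidalCategory CartesianMonoidalCategory
open Literature.AlgebraicGeometry.Motives Literature.AlgebraicGeometry.HodgeTheory
open Literature.AlgebraicGeometry.Surfaces Literature.Geometry.Kaehler
open Literature.AlgebraicTopology.SingularHomology

/-- `KunnethSpan`: **the spanning half of the Künneth formula** for the complex points of smooth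
projective varieties — every class on `(Y ⊗ Z)(ℂ)` is a `ℂ`-combination of cross products
`fst^* b ∪ snd^* w` (Hatcher Thm. 3.15 with Cor. A.12); symbol for symbol the hypothesis `hK` of
`gysin_baseChange_of_kunneth` and of the sibling files of this route. Local notation only. -/
local notation3 (prettyPrint := false) "KunnethSpan" =>
  ∀ ⦃m' n' : ℕ⦄ ⦃Y' Z' : SchemeOver ℂ⦄, IsSmoothProjective m' Y' → IsSmoothProjective n' Z' →
    ∀ (k : ℕ) (z : complexBetti (MonoidalCategoryStruct.tensorObj Y' Z') k), z ∈ Submodule.span ℂ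
      {v | ∃ (i j : ℕ) (h : i + j = k) (b : complexBetti Y' i) (w : complexBetti Z' j),
        v = cupProduct h (complexBetti.map (SemiCartesianMonoidalCategory.fst Y' Z') i b)
          (complexBetti.map (SemiCartesianMonoidalCategory.snd Y' Z') j w)}

/-- `OddBettiVanish`: **the odd cohomology of a projective K3 surface vanishes** — `H¹(S(ℂ); ℂ) = 0`
and `H³(S(ℂ); ℂ) = 0` for every `S` with `IsK3Surface S` (Huybrechts, *Lectures on K3 Surfaces*,
Ch. 1 §3.2: "`H¹(X, ℤ) = 0` and by Poincaré duality also `H³(X, ℤ) = 0`"; §3.3: "hence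
`H¹(X, ℂ) = 0`"). Taken as an inline hypothesis (the body of the named fact
`Huybrechts_K3_oddBetti_vanish` proposed for `Literature/AlgebraicGeometry/Surfaces/K3BettiNumbers`);
the parallel file `…SquareHodgeOfSqrtTwoOfKunneth` uses its `H¹`-half `hb₁` likewise. Local notation only. -/
local notation3 (prettyPrint := false) "OddBettiVanish" =>
  ∀ S : SchemeOver ℂ, IsK3Surface S → Subsingleton (complexBetti S 1) ∧ Subsingleton (complexBetti S 3)

/-- **The CYCLE PART of the sector `SquareHodgeOfSqrtTwo`, modulo named facts and Künneth spanning —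
without `nonempty_hodgeModel`.** Under `RealMultiplicationSqrtTwoAlgebraic` and `LefschetzOneOneK3`, for
every projective K3 surface `S` and `e` as in `SquareHodgeOfSqrtTwo` (real multiplication by `√2`,
`End_Hdg(T) ⊆ ℚ + ℚe`), every rational `(p,p)`-class on `S ⊗ S` is algebraic — the second conjunct of
`HodgeConjectureFor 4 (S ⊗ S)` (its Hodge-type hypothesis supplies the Hodge model of `S ⊗ S`).
Hypotheses: `exists_deRhamIsoFamily`, the Künneth spanning property `KunnethSpan`, `Huybrechts_K3_marking_exists`, `Huybrechts_K3_hodgeTypes_H2`,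
`Grothendieck1969_supportedClasses_le_hodgeConiveau`, `OddBettiVanish` (`H¹ = H³ = 0`). Degree by degree:
`Hdg⁰ = H⁰`; `Hdg² = pr₁^*NS + pr₂^*NS` and `Hdg⁶ = NS⊗[pt] + [pt]⊗NS`
(`mem_algebraicClasses_one/three_of_kunneth`); `Hdg⁴ = ℚ[S×pt] + ℚ[pt×S] + NS⊗NS + ℚ[Δ] + ℚγₑ`
through `End_Hdg ⊆ ℚ + ℚe` and the algebraicity of `e` (`mem_algebraicClasses_two_of_sector`);
`Hdg⁸ = H⁸`; nothing above. (The independence of Hodge types from the model,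
`hodgePQ_independent_of_hodgeModel`, is the tree's theorem `hodgePQ_independent_of_hodgeModel_holds`.)
[cite: Varesco2023, §2 (p. 8)] [cite: Huybrechts2019, Cor. 0.4 (ii) and Rem. 3.3] -/
theorem squareHodge_cyclePart_of_facts
    (hdR : ∀ (E : Type) [NormedAddCommGroup E] [NormedSpace ℂ E] [FiniteDimensional ℂ E],
      Literature.NumberTheory.Transcendental.exists_deRhamIsoFamily 𝓘(ℝ, E))
    (hK : KunnethSpan) (hmark : Huybrechts_K3_marking_exists) (hHT : Huybrechts_K3_hodgeTypes_H2)
    (hG : Grothendieck1969_supportedClasses_le_hodgeConiveau) (hodd : OddBettiVanish)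
    (hRM : Theses.NikulinTwinTransport.RealMultiplicationSqrtTwoAlgebraic)
    (hL11 : Theses.NikulinTwinTransport.LefschetzOneOneK3)
    (S : SchemeOver ℂ)
    (hS : (IsSmoothProjective 2 S ∧ Subsingleton (structureSheafCohomology S.left 1) ∧
      ∃ (A : HodgeModel 2 S) (η : MForm 𝓘(ℝ, A.model) A.carrier ℂ 2), IsHolomorphicInCharts η ∧ ∀ x, η x ≠ 0))
    (e : complexBetti S (2 * 1) →ₗ[ℂ] complexBetti S (2 * 1))
    (he_rat : ∀ x, IsRationalClass x → IsRationalClass (e x))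
    (he_typ : ∀ (i j : ℕ) x, IsOfHodgeType 2 S (2 * 1) i j x → IsOfHodgeType 2 S (2 * 1) i j (e x))
    (he_adj : ∀ x y : complexBetti S (2 * 1), cupProduct (rfl : 2 * 1 + 2 * 1 = 2 * 2) (e x) y =
      cupProduct (rfl : 2 * 1 + 2 * 1 = 2 * 2) x (e y))
    (he_N : ∀ d ∈ algebraicClasses S 1, e d = 0)
    (he_T : ∀ x : complexBetti S (2 * 1),
      (∀ d ∈ algebraicClasses S 1, cupProduct (rfl : 2 * 1 + 2 * 1 = 2 * 2) x d = 0) → e (e x) = (2 : ℂ) • x)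
    (hU : ∀ (f : complexBetti S (2 * 1) →ₗ[ℂ] complexBetti S (2 * 1)),
      (∀ x, IsRationalClass x → IsRationalClass (f x)) →
      (∀ (i j : ℕ) x, IsOfHodgeType 2 S (2 * 1) i j x → IsOfHodgeType 2 S (2 * 1) i j (f x)) →
      (∀ d ∈ algebraicClasses S 1, f d = 0) →
      (∀ x : complexBetti S (2 * 1), ∀ d ∈ algebraicClasses S 1,
        cupProduct (rfl : 2 * 1 + 2 * 1 = 2 * 2) (f x) d = 0) →
      ∃ a b : ℚ, ∀ x : complexBetti S (2 * 1),
        (∀ d ∈ algebraicClasses S 1, cupProduct (rfl : 2 * 1 + 2 * 1 = 2 * 2) x d = 0) →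
        f x = (a : ℂ) • x + (b : ℂ) • e x)
    (p : ℕ) (c : complexBetti (S ⊗ S) (2 * p)) (hc : IsRationalClass c)
    (hct : IsOfHodgeType 4 (S ⊗ S) (2 * p) p p c) :
    c ∈ algebraicClasses (S ⊗ S) p := by
  have hI : hodgePQ_independent_of_hodgeModel := hodgePQ_independent_of_hodgeModel_holds
  let μ : OrientationFamily := fun _ _ h ↦ Classical.choice (ComplexPoints.isOrientableOver ℂ h)
  have hP : IsSmoothProjective (2 + 2) (S ⊗ S) := IsSmoothProjective.tensor_holds hS.1 hS.1
  -- inputs on `S`: Lefschetz `(1,1)`, odd cohomology, a Hodge model, a rational generator of `H⁴`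
  have hL11' : ∀ c : complexBetti S (2 * 1), IsRationalClass c → IsOfHodgeType 2 S (2 * 1) 1 1 c →
      c ∈ algebraicClasses S 1 := fun c hc h11 => hL11 S hS c hc h11
  obtain ⟨h1, h3⟩ := hodd S hS
  obtain ⟨A, -⟩ := hS.2.2
  obtain ⟨η, p₀, x, hp₀, ⟨hp₀int, -, -, -, -, -⟩, -⟩ := hmark S hS
  have hp₀rat : IsRationalClass p₀ := hp₀int.isRationalClass
  rcases (show p = 0 ∨ p = 1 ∨ p = 2 ∨ p = 3 ∨ p = 4 ∨ 4 < p by omega) with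
    rfl | rfl | rfl | rfl | rfl | hp
  · rw [algebraicClasses_zero]
    exact Submodule.mem_top
  · exact mem_algebraicClasses_one_of_kunneth hI hdR μ hS.1 A (hK hS.1 hS.1 6) (hK hS.1 hS.1 _) h3 hp₀
      hp₀rat hL11' c hc hct
  · have hγe := hRM μ μ.hasPoincareDuality S hS e he_rat he_typ he_adj he_N he_T
    exact mem_algebraicClasses_two_of_sector hI hdR hmark hHT hG μ hS (hK hS.1 hS.1 (2 * 2))
      (hK hS.1 hS.1 _) h1 h3 hL11' e he_rat he_N he_T hγe hU c hc hct
  · exact mem_algebraicClasses_three_of_kunneth hI hdR μ hS.1 A (hK hS.1 hS.1 2) (hK hS.1 hS.1 _) h1 hp₀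
      hL11' c hc hct
  · exact mem_algebraicClasses_of_degree_top hP (by norm_num) c
  · haveI := subsingleton_complexBetti hP (show 2 * (2 + 2) < 2 * p by omega)
    rw [Subsingleton.elim c 0]
    exact Submodule.zero_mem _

/-- **The glue `SquareGlue` modulo the tree's named facts and Künneth spanning.** From
`exists_deRhamIsoFamily`, the Künneth spanning property
`KunnethSpan`, `Huybrechts_K3_marking_exists`, `Huybrechts_K3_hodgeTypes_H2`,
`Grothendieck1969_supportedClasses_le_hodgeConiveau`, `OddBettiVanish` (the cycle part,
`squareHodge_cyclePart_of_facts`) and `nonempty_hodgeModel` — used ONLY for the anti-vacuity conjunct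
`Nonempty (HodgeModel 4 (S ⊗ S))` of `HodgeConjectureFor 4 (S ⊗ S)`, which no hypothesis of the glue
supplies —: `RealMultiplicationSqrtTwoAlgebraic → LefschetzOneOneK3 → SquareHodgeOfSqrtTwo`.
[cite: Varesco2023, §2 (p. 8)] [cite: Huybrechts2019, Cor. 0.4 (ii) and Rem. 3.3] -/
theorem squareGlue_of_facts (hM : ∀ (d : ℕ) (W : SchemeOver ℂ), nonempty_hodgeModel d W)
    (hdR : ∀ (E : Type) [NormedAddCommGroup E] [NormedSpace ℂ E] [FiniteDimensional ℂ E],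
      Literature.NumberTheory.Transcendental.exists_deRhamIsoFamily 𝓘(ℝ, E))
    (hK : KunnethSpan) (hmark : Huybrechts_K3_marking_exists) (hHT : Huybrechts_K3_hodgeTypes_H2)
    (hG : Grothendieck1969_supportedClasses_le_hodgeConiveau) (hodd : OddBettiVanish) :
    Theses.NikulinTwinTransport.SquareGlue := by
  intro hRM hL11 S hS e he_rat he_typ he_adj he_N he_T hU
  exact ⟨(hM 4 (S ⊗ S)).nonempty (IsSmoothProjective.tensor_holds hS.1 hS.1),
    fun p c hc hct => squareHodge_cyclePart_of_facts hdR hK hmark hHT hG hodd hRM hL11 S hS e he_rat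
      he_typ he_adj he_N he_T hU p c hc hct⟩

/-! ### Consequence for the route: `Assembly` modulo the same facts -/

/-- **The frame `Assembly` (stmt-HodgeConjecture-13942) modulo named facts and Künneth spanning**:
`TwinSimilitudeAlgebraic → HodgeIsometryAlgebraic → TwinExists → LefschetzOneOneK3 → SectorComplement →
HodgeConjecture`, from `squareGlue_of_facts` and seat 3's `assembly_of_squareGlue_of_kunneth` (which
discharges `RealMultiplicationGlue` from the three K3 facts and Künneth spanning); the trust base is
`nonempty_hodgeModel`, `exists_deRhamIsoFamily`, `Huybrechts_K3_marking_exists`,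
`Huybrechts_K3_hodgeTypes_H2`, `Grothendieck1969_supportedClasses_le_hodgeConiveau`,
`OddBettiVanish` and `KunnethSpan`. [cite: Varesco2023, §2 (p. 8) and Thm. 2.1] -/
theorem assembly_of_facts (hM : ∀ (d : ℕ) (W : SchemeOver ℂ), nonempty_hodgeModel d W)
    (hdR : ∀ (E : Type) [NormedAddCommGroup E] [NormedSpace ℂ E] [FiniteDimensional ℂ E],
      Literature.NumberTheory.Transcendental.exists_deRhamIsoFamily 𝓘(ℝ, E))
    (hK : KunnethSpan) (hmark : Huybrechts_K3_marking_exists) (hHT : Huybrechts_K3_hodgeTypes_H2)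
    (hG : Grothendieck1969_supportedClasses_le_hodgeConiveau) (hodd : OddBettiVanish) :
    Theses.NikulinTwinTransport.Assembly :=
  assembly_of_squareGlue_of_kunneth (squareGlue_of_facts hM hdR hK hmark hHT hG hodd) hmark hHT hG hK

/-! ### The same, with the odd-Betti vanishing supplied by the tree's named fact -/

/-- **`SquareGlue` modulo NAMED FACTS of the tree and Künneth spanning**: `squareGlue_of_facts` with the
odd-Betti hypothesis supplied by the named fact `Huybrechts_K3_oddBetti_vanish`
(`Literature/AlgebraicGeometry/Surfaces/K3BettiNumbers`; its body is the inline `OddBettiVanish`). Trust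
base: `nonempty_hodgeModel` (model conjunct only), `exists_deRhamIsoFamily`, `Huybrechts_K3_marking_exists`,
`Huybrechts_K3_hodgeTypes_H2`, `Grothendieck1969_supportedClasses_le_hodgeConiveau`,
`Huybrechts_K3_oddBetti_vanish`, and the Künneth spanning property `KunnethSpan`.
[cite: Varesco2023, §2 (p. 8)] [cite: Huybrechts2016K3, Ch. 1 §3.2 and §3.3] -/
theorem squareGlue_of_namedFacts (hM : ∀ (d : ℕ) (W : SchemeOver ℂ), nonempty_hodgeModel d W)
    (hdR : ∀ (E : Type) [NormedAddCommGroup E] [NormedSpace ℂ E] [FiniteDimensional ℂ E],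
      Literature.NumberTheory.Transcendental.exists_deRhamIsoFamily 𝓘(ℝ, E))
    (hK : KunnethSpan) (hmark : Huybrechts_K3_marking_exists) (hHT : Huybrechts_K3_hodgeTypes_H2)
    (hG : Grothendieck1969_supportedClasses_le_hodgeConiveau) (hodd : Huybrechts_K3_oddBetti_vanish) :
    Theses.NikulinTwinTransport.SquareGlue :=
  squareGlue_of_facts hM hdR hK hmark hHT hG hodd

/-- **The cycle part of the sector modulo NAMED FACTS and Künneth spanning** (no `nonempty_hodgeModel`):
`squareHodge_cyclePart_of_facts` with `Huybrechts_K3_oddBetti_vanish`. [cite: Varesco2023, §2 (p. 8)]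
[cite: Huybrechts2016K3, Ch. 1 §3.2 and §3.3] -/
theorem squareHodge_cyclePart_of_namedFacts
    (hdR : ∀ (E : Type) [NormedAddCommGroup E] [NormedSpace ℂ E] [FiniteDimensional ℂ E],
      Literature.NumberTheory.Transcendental.exists_deRhamIsoFamily 𝓘(ℝ, E))
    (hK : KunnethSpan) (hmark : Huybrechts_K3_marking_exists) (hHT : Huybrechts_K3_hodgeTypes_H2)
    (hG : Grothendieck1969_supportedClasses_le_hodgeConiveau) (hodd : Huybrechts_K3_oddBetti_vanish)
    (hRM : Theses.NikulinTwinTransport.RealMultiplicationSqrtTwoAlgebraic)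
    (hL11 : Theses.NikulinTwinTransport.LefschetzOneOneK3)
    (S : SchemeOver ℂ) (hS : IsK3Surface S)
    (e : complexBetti S (2 * 1) →ₗ[ℂ] complexBetti S (2 * 1))
    (he_rat : ∀ x, IsRationalClass x → IsRationalClass (e x))
    (he_typ : ∀ (i j : ℕ) x, IsOfHodgeType 2 S (2 * 1) i j x → IsOfHodgeType 2 S (2 * 1) i j (e x))
    (he_adj : ∀ x y : complexBetti S (2 * 1), cupProduct (rfl : 2 * 1 + 2 * 1 = 2 * 2) (e x) y =
      cupProduct (rfl : 2 * 1 + 2 * 1 = 2 * 2) x (e y))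
    (he_N : ∀ d ∈ algebraicClasses S 1, e d = 0)
    (he_T : ∀ x : complexBetti S (2 * 1),
      (∀ d ∈ algebraicClasses S 1, cupProduct (rfl : 2 * 1 + 2 * 1 = 2 * 2) x d = 0) → e (e x) = (2 : ℂ) • x)
    (hU : ∀ (f : complexBetti S (2 * 1) →ₗ[ℂ] complexBetti S (2 * 1)),
      (∀ x, IsRationalClass x → IsRationalClass (f x)) →
      (∀ (i j : ℕ) x, IsOfHodgeType 2 S (2 * 1) i j x → IsOfHodgeType 2 S (2 * 1) i j (f x)) →
      (∀ d ∈ algebraicClasses S 1, f d = 0) →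
      (∀ x : complexBetti S (2 * 1), ∀ d ∈ algebraicClasses S 1,
        cupProduct (rfl : 2 * 1 + 2 * 1 = 2 * 2) (f x) d = 0) →
      ∃ a b : ℚ, ∀ x : complexBetti S (2 * 1),
        (∀ d ∈ algebraicClasses S 1, cupProduct (rfl : 2 * 1 + 2 * 1 = 2 * 2) x d = 0) →
        f x = (a : ℂ) • x + (b : ℂ) • e x)
    (p : ℕ) (c : complexBetti (S ⊗ S) (2 * p)) (hc : IsRationalClass c)
    (hct : IsOfHodgeType 4 (S ⊗ S) (2 * p) p p c) :
    c ∈ algebraicClasses (S ⊗ S) p :=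
  squareHodge_cyclePart_of_facts hdR hK hmark hHT hG hodd hRM hL11 S hS e he_rat he_typ he_adj he_N he_T hU p c hc hct

/-- **The frame `Assembly` modulo NAMED FACTS and Künneth spanning**: `assembly_of_facts` with
`Huybrechts_K3_oddBetti_vanish`. [cite: Varesco2023, §2 (p. 8) and Thm. 2.1] -/
theorem assembly_of_namedFacts (hM : ∀ (d : ℕ) (W : SchemeOver ℂ), nonempty_hodgeModel d W)
    (hdR : ∀ (E : Type) [NormedAddCommGroup E] [NormedSpace ℂ E] [FiniteDimensional ℂ E],
      Literature.NumberTheory.Transcendental.exists_deRhamIsoFamily 𝓘(ℝ, E))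
    (hK : KunnethSpan) (hmark : Huybrechts_K3_marking_exists) (hHT : Huybrechts_K3_hodgeTypes_H2)
    (hG : Grothendieck1969_supportedClasses_le_hodgeConiveau) (hodd : Huybrechts_K3_oddBetti_vanish) :
    Theses.NikulinTwinTransport.Assembly :=
  assembly_of_facts hM hdR hK hmark hHT hG hodd

/-! ### The same, with the Künneth spanning property supplied by the tree's theorem -/

/-- **`SquareGlue` modulo NAMED FACTS of the tree only.** The Künneth spanning property `KunnethSpan` is
the tree's theorem `Hatcher2002_crossProducts_span_complexBetti_holds` (Künneth for the compact manifolds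
`Y(ℂ)`, `Z(ℂ)` via Leray–Hirsch, `kunnethSpan_complexBetti`), so `SquareGlue` follows from the named facts
`nonempty_hodgeModel` (for the model conjunct only), `exists_deRhamIsoFamily`,
`Huybrechts_K3_marking_exists`, `Huybrechts_K3_hodgeTypes_H2`,
`Grothendieck1969_supportedClasses_le_hodgeConiveau` and `Huybrechts_K3_oddBetti_vanish` — and nothing else.
[cite: Varesco2023, §2 (p. 8)] [cite: HatcherAT2002, §3.2 Thm. 3.15] -/
theorem squareGlue_of_namedFacts' (hM : ∀ (d : ℕ) (W : SchemeOver ℂ), nonempty_hodgeModel d W)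
    (hdR : ∀ (E : Type) [NormedAddCommGroup E] [NormedSpace ℂ E] [FiniteDimensional ℂ E],
      Literature.NumberTheory.Transcendental.exists_deRhamIsoFamily 𝓘(ℝ, E))
    (hmark : Huybrechts_K3_marking_exists) (hHT : Huybrechts_K3_hodgeTypes_H2)
    (hG : Grothendieck1969_supportedClasses_le_hodgeConiveau) (hodd : Huybrechts_K3_oddBetti_vanish) :
    Theses.NikulinTwinTransport.SquareGlue :=
  squareGlue_of_namedFacts hM hdR Hatcher2002_crossProducts_span_complexBetti_holds hmark hHT hG hodd

/-- **The cycle part of the sector modulo NAMED FACTS only** (no `nonempty_hodgeModel`, no Künneth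
hypothesis): every rational `(p,p)`-class on `S ⊗ S` is algebraic on the sector, from
`exists_deRhamIsoFamily`, `Huybrechts_K3_marking_exists`, `Huybrechts_K3_hodgeTypes_H2`,
`Grothendieck1969_supportedClasses_le_hodgeConiveau`, `Huybrechts_K3_oddBetti_vanish`.
[cite: Varesco2023, §2 (p. 8)] [cite: HatcherAT2002, §3.2 Thm. 3.15] -/
theorem squareHodge_cyclePart_of_namedFacts'
    (hdR : ∀ (E : Type) [NormedAddCommGroup E] [NormedSpace ℂ E] [FiniteDimensional ℂ E],
      Literature.NumberTheory.Transcendental.exists_deRhamIsoFamily 𝓘(ℝ, E))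
    (hmark : Huybrechts_K3_marking_exists) (hHT : Huybrechts_K3_hodgeTypes_H2)
    (hG : Grothendieck1969_supportedClasses_le_hodgeConiveau) (hodd : Huybrechts_K3_oddBetti_vanish)
    (hRM : Theses.NikulinTwinTransport.RealMultiplicationSqrtTwoAlgebraic)
    (hL11 : Theses.NikulinTwinTransport.LefschetzOneOneK3)
    (S : SchemeOver ℂ) (hS : IsK3Surface S)
    (e : complexBetti S (2 * 1) →ₗ[ℂ] complexBetti S (2 * 1))
    (he_rat : ∀ x, IsRationalClass x → IsRationalClass (e x))
    (he_typ : ∀ (i j : ℕ) x, IsOfHodgeType 2 S (2 * 1) i j x → IsOfHodgeType 2 S (2 * 1) i j (e x))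
    (he_adj : ∀ x y : complexBetti S (2 * 1), cupProduct (rfl : 2 * 1 + 2 * 1 = 2 * 2) (e x) y =
      cupProduct (rfl : 2 * 1 + 2 * 1 = 2 * 2) x (e y))
    (he_N : ∀ d ∈ algebraicClasses S 1, e d = 0)
    (he_T : ∀ x : complexBetti S (2 * 1),
      (∀ d ∈ algebraicClasses S 1, cupProduct (rfl : 2 * 1 + 2 * 1 = 2 * 2) x d = 0) → e (e x) = (2 : ℂ) • x)
    (hU : ∀ (f : complexBetti S (2 * 1) →ₗ[ℂ] complexBetti S (2 * 1)),
      (∀ x, IsRationalClass x → IsRationalClass (f x)) →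
      (∀ (i j : ℕ) x, IsOfHodgeType 2 S (2 * 1) i j x → IsOfHodgeType 2 S (2 * 1) i j (f x)) →
      (∀ d ∈ algebraicClasses S 1, f d = 0) →
      (∀ x : complexBetti S (2 * 1), ∀ d ∈ algebraicClasses S 1,
        cupProduct (rfl : 2 * 1 + 2 * 1 = 2 * 2) (f x) d = 0) →
      ∃ a b : ℚ, ∀ x : complexBetti S (2 * 1),
        (∀ d ∈ algebraicClasses S 1, cupProduct (rfl : 2 * 1 + 2 * 1 = 2 * 2) x d = 0) →
        f x = (a : ℂ) • x + (b : ℂ) • e x)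
    (p : ℕ) (c : complexBetti (S ⊗ S) (2 * p)) (hc : IsRationalClass c)
    (hct : IsOfHodgeType 4 (S ⊗ S) (2 * p) p p c) :
    c ∈ algebraicClasses (S ⊗ S) p :=
  squareHodge_cyclePart_of_namedFacts hdR Hatcher2002_crossProducts_span_complexBetti_holds hmark hHT hG hodd
    hRM hL11 S hS e he_rat he_typ he_adj he_N he_T hU p c hc hct

/-- **The frame `Assembly` modulo NAMED FACTS only**: `TwinSimilitudeAlgebraic → HodgeIsometryAlgebraic →
TwinExists → LefschetzOneOneK3 → SectorComplement → HodgeConjecture` from `nonempty_hodgeModel`,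
`exists_deRhamIsoFamily`, `Huybrechts_K3_marking_exists`, `Huybrechts_K3_hodgeTypes_H2`,
`Grothendieck1969_supportedClasses_le_hodgeConiveau`, `Huybrechts_K3_oddBetti_vanish`.
[cite: Varesco2023, §2 (p. 8) and Thm. 2.1] -/
theorem assembly_of_namedFacts' (hM : ∀ (d : ℕ) (W : SchemeOver ℂ), nonempty_hodgeModel d W)
    (hdR : ∀ (E : Type) [NormedAddCommGroup E] [NormedSpace ℂ E] [FiniteDimensional ℂ E],
      Literature.NumberTheory.Transcendental.exists_deRhamIsoFamily 𝓘(ℝ, E))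
    (hmark : Huybrechts_K3_marking_exists) (hHT : Huybrechts_K3_hodgeTypes_H2)
    (hG : Grothendieck1969_supportedClasses_le_hodgeConiveau) (hodd : Huybrechts_K3_oddBetti_vanish) :
    Theses.NikulinTwinTransport.Assembly :=
  assembly_of_namedFacts hM hdR Hatcher2002_crossProducts_span_complexBetti_holds hmark hHT hG hodd

end Summit.HodgeConjecture.HodgeConjecture.Theorems.NikulinTwinTransport

end
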